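import Mathlib
import Literature.MathematicalPhysics.StatisticalMechanics.HaggStacking
import Literature.MathematicalPhysics.StatisticalMechanics.BarlowStacking

/-!
# Sequential compactness of admissible layered-pattern parameters (piece X of node «CoerciveStraightening», part 1)

Helper for the residual crux `ChartedPlanarOrder.ChartedZeroExcessLayered`
(stmt-AtomisticToContinuum-26636; decomposition cell decomp-a2c, lens-3, generation 11).

`extraction`: given admissible pattern parameters `(b_n ∈ [9/10,1], A_n` linear isometry`, s_n` Hägg
sequence`, z_n` heights with gaps in `[39/50 b_n, 17/20 b_n]`, `z_n 0 = 0)`, along a subsequence the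
pattern points `A_n (i u(b_n) + j v(b_n) + L_{s_n}(m) w(b_n) + z_n(m) e₃)` with `|m| ≤ 7` converge to
the corresponding points of an admissible limit pattern `(b, A, s, z)`. Proof: Bolzano–Weierstrass in
`ℝ × (Fin 3 → ℝ³) × (Fin 15 → ℝ)`, pigeonhole on the `{±1}`-window, the pointwise limit of linear
isometries is a linear isometry, free extension of the heights outside the window with gap `4/5 b`;
the scaling identities `u(b) = b • u(1)` etc. are inlined). Used by `ChartedPlanarOrderWindowExactOfMatched`. [folklore compactness]
-/

namespace Summit.AtomisticToContinuum.Crystallization.Theorems.ChartedPlanarOrderPatternExtraction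

open Filter Topology Literature.MathematicalPhysics.StatisticalMechanics

/-- labels in the window `|m| ≤ 7` only depend on the sequence in the window. -/
theorem haggLabel_congr_window (s s' : ℤ → ℤ) (h : ∀ k : ℤ, -7 ≤ k → k ≤ 7 → s k = s' k)
    (m : ℤ) (hm : |m| ≤ 7) : haggLabel s m = haggLabel s' m := by
  obtain ⟨hm1, hm2⟩ := abs_le.1 hm
  rcases le_or_gt 0 m with h0 | h0
  · obtain ⟨n, rfl⟩ : ∃ n : ℕ, m = n := ⟨m.toNat, by omega⟩
    rw [haggLabel_natCast, haggLabel_natCast, haggWindow, haggWindow]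
    refine Finset.sum_congr rfl fun i hi => ?_
    rw [Finset.mem_range] at hi
    exact h _ (by omega) (by omega)
  · obtain ⟨n, rfl⟩ : ∃ n : ℕ, m = -(n:ℤ) := ⟨(-m).toNat, by omega⟩
    rw [haggLabel_neg_natCast, haggLabel_neg_natCast, haggWindow, haggWindow]
    congr 1
    refine Finset.sum_congr rfl fun i hi => ?_
    rw [Finset.mem_range] at hi
    exact h _ (by omega) (by omega)

/-- two-sided linear growth of admissible heights. -/
theorem height_bounds (b : ℝ) (hb : 0 ≤ b) (z : ℤ → ℝ)
    (hz : (∀ m : ℤ, 39 / 50 * b ≤ z (m + 1) - z m ∧ z (m + 1) - z m ≤ 17 / 20 * b) ∧ z 0 = 0) :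
    ∀ m : ℤ, 39 / 50 * b * |(m : ℝ)| ≤ |z m| ∧ |z m| ≤ 17 / 20 * b * |(m : ℝ)| := by
  have hup : ∀ n : ℕ, (n : ℝ) * (39 / 50 * b) ≤ z n ∧ z n ≤ (n : ℝ) * (17 / 20 * b) := by
    intro n
    induction n with
    | zero => simp [hz.2]
    | succ n ih =>
      have := hz.1 n
      push_cast; constructor <;> linarith [this.1, this.2]
  have hdn : ∀ n : ℕ, -((n : ℝ) * (17 / 20 * b)) ≤ z (-(n:ℤ)) ∧ z (-(n:ℤ)) ≤ -((n : ℝ) * (39 / 50 * b)) := by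
    intro n
    induction n with
    | zero => simp [hz.2]
    | succ n ih =>
      have h' := hz.1 (-((n+1 : ℕ) : ℤ))
      rw [show (-((n+1 : ℕ) : ℤ) + 1) = -(n:ℤ) by push_cast; ring] at h'
      push_cast at h' ⊢; constructor <;> linarith [h'.1, h'.2]
  intro m
  rcases le_or_gt 0 m with h0 | h0
  · obtain ⟨n, rfl⟩ : ∃ n : ℕ, m = n := ⟨m.toNat, by omega⟩
    have h1 := hup n
    have hn : (0:ℝ) ≤ n := Nat.cast_nonneg n
    have hzn : 0 ≤ z n := le_trans (by positivity) h1.1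
    rw [Int.cast_natCast, abs_of_nonneg hn, abs_of_nonneg hzn]
    constructor <;> linarith [h1.1, h1.2]
  · obtain ⟨n, rfl⟩ : ∃ n : ℕ, m = -(n:ℤ) := ⟨(-m).toNat, by omega⟩
    have h1 := hdn n
    have hn : (0:ℝ) ≤ n := Nat.cast_nonneg n
    have hzn : z (-(n:ℤ)) ≤ 0 := le_trans h1.2 (by nlinarith)
    rw [Int.cast_neg, Int.cast_natCast, abs_neg, abs_of_nonneg hn, abs_of_nonpos hzn]
    constructor <;> linarith [h1.1, h1.2]


/-- analytic core of the extraction: Bolzano–Weierstrass + window pigeonhole + limit isometry. -/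
theorem extraction_core (bs : ℕ → ℝ) (As : ℕ → (EuclideanSpace ℝ (Fin 3) →ₗᵢ[ℝ] EuclideanSpace ℝ (Fin 3))) (ss : ℕ → ℤ → ℤ) (zs : ℕ → ℤ → ℝ)
    (hb : ∀ n, 9 / 10 ≤ bs n ∧ bs n ≤ 1) (hs : ∀ n, IsHaggSeq (ss n))
    (hz : ∀ n, (∀ m : ℤ, 39 / 50 * bs n ≤ zs n (m + 1) - zs n m ∧ zs n (m + 1) - zs n m ≤ 17 / 20 * bs n) ∧ zs n 0 = 0) :
    ∃ Φ : ℕ → ℕ, StrictMono Φ ∧ ∃ b : ℝ, (9 / 10 ≤ b ∧ b ≤ 1) ∧ Tendsto (fun n => bs (Φ n)) atTop (𝓝 b) ∧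
      ∃ A : EuclideanSpace ℝ (Fin 3) →ₗᵢ[ℝ] EuclideanSpace ℝ (Fin 3), (∀ x, Tendsto (fun n => As (Φ n) x) atTop (𝓝 (A x))) ∧
      ∃ zw : ℤ → ℝ, (∀ m : ℤ, -7 ≤ m → m ≤ 7 → Tendsto (fun n => zs (Φ n) m) atTop (𝓝 (zw m))) ∧
        (∀ n : ℕ, ∀ m : ℤ, -7 ≤ m → m ≤ 7 → ss (Φ n) m = ss (Φ 0) m) := by
  -- packaging into a proper space
  let X : ℕ → ℝ × (Fin 3 → EuclideanSpace ℝ (Fin 3)) × (Fin 15 → ℝ) :=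
    fun n => (bs n, fun k => As n (EuclideanSpace.single k (1:ℝ)), fun t => zs n (((t : ℕ) : ℤ) - 7))
  have hbd : ∀ n, X n ∈ Metric.closedBall (0 : ℝ × (Fin 3 → EuclideanSpace ℝ (Fin 3)) × (Fin 15 → ℝ)) 7 := by
    intro n
    rw [Metric.mem_closedBall, dist_zero_right]
    have hb7 : ‖bs n‖ ≤ 7 := by
      rw [Real.norm_eq_abs, abs_le]; constructor <;> linarith [(hb n).1, (hb n).2]
    have hV7 : ‖(fun k : Fin 3 => As n (EuclideanSpace.single k (1:ℝ)))‖ ≤ 7 := by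
      refine (pi_norm_le_iff_of_nonneg (by norm_num)).2 fun k => ?_
      rw [LinearIsometry.norm_map]; simp
    have hz7 : ‖(fun t : Fin 15 => zs n (((t : ℕ) : ℤ) - 7))‖ ≤ 7 := by
      refine (pi_norm_le_iff_of_nonneg (by norm_num)).2 fun t => ?_
      rw [Real.norm_eq_abs]
      have h := (height_bounds (bs n) (by linarith [(hb n).1]) (zs n) (hz n) (((t:ℕ):ℤ) - 7)).2
      have ht14 : ((t : ℕ) : ℝ) ≤ 14 := by exact_mod_cast (show (t:ℕ) ≤ 14 by omega)
      have ht0 : (0:ℝ) ≤ ((t : ℕ) : ℝ) := Nat.cast_nonneg _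
      have ht : |((((t:ℕ):ℤ) - 7 : ℤ) : ℝ)| ≤ 7 := by
        push_cast; rw [abs_le]; constructor <;> linarith
      have hm := mul_le_mul (show 17 / 20 * bs n ≤ 17 / 20 by linarith [(hb n).2]) ht (abs_nonneg _) (by norm_num)
      linarith
    simp only [X, Prod.norm_def]
    exact max_le hb7 (max_le hV7 hz7)
  obtain ⟨a, -, φ, hφ, hlim⟩ := tendsto_subseq_of_bounded Metric.isBounded_closedBall hbd
  -- component limits
  have hb' : Tendsto (fun n => bs (φ n)) atTop (𝓝 a.1) := (continuous_fst.tendsto a).comp hlim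
  have hV : ∀ k : Fin 3, Tendsto (fun n => As (φ n) (EuclideanSpace.single k (1:ℝ))) atTop (𝓝 (a.2.1 k)) :=
    fun k => ((continuous_apply k).tendsto _).comp ((continuous_fst.tendsto _).comp ((continuous_snd.tendsto a).comp hlim))
  have hZ : ∀ t : Fin 15, Tendsto (fun n => zs (φ n) (((t : ℕ) : ℤ) - 7)) atTop (𝓝 (a.2.2 t)) :=
    fun t => ((continuous_apply t).tendsto _).comp ((continuous_snd.tendsto _).comp ((continuous_snd.tendsto a).comp hlim))
  have hbW : 9 / 10 ≤ a.1 ∧ a.1 ≤ 1 :=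
    ⟨ge_of_tendsto hb' (Filter.Eventually.of_forall fun n => (hb (φ n)).1),
     le_of_tendsto hb' (Filter.Eventually.of_forall fun n => (hb (φ n)).2)⟩
  -- pigeonhole on the Bool windows
  let w : ℕ → (Fin 15 → Bool) := fun n t => decide (ss (φ n) (((t : ℕ) : ℤ) - 7) = 1)
  obtain ⟨c, hc⟩ := Finite.exists_infinite_fiber w
  have hfreq : ∃ᶠ n in atTop, w n = c := by
    rw [Nat.frequently_atTop_iff_infinite]
    have h' := hc
    rw [Set.infinite_coe_iff] at h'
    exact h'.mono fun n hn => by simpa using hn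
  obtain ⟨ψ, hψ, hwψ⟩ := extraction_of_frequently_atTop hfreq
  refine ⟨φ ∘ ψ, hφ.comp hψ, a.1, hbW, hb'.comp hψ.tendsto_atTop, ?_⟩
  -- the limit isometry
  have hAx : ∀ x : EuclideanSpace ℝ (Fin 3),
      Tendsto (fun n => As (φ (ψ n)) x) atTop (𝓝 (∑ k, x k • a.2.1 k)) := by
    intro x
    have hxe : x = ∑ k, x k • EuclideanSpace.single k (1:ℝ) := by
      conv_lhs => rw [← (EuclideanSpace.basisFun (Fin 3) ℝ).sum_repr x]
      simp [EuclideanSpace.basisFun_apply]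
    have hx : ∀ n, As (φ (ψ n)) x = ∑ k, x k • As (φ (ψ n)) (EuclideanSpace.single k (1:ℝ)) := by
      intro n
      conv_lhs => rw [hxe]
      simp [map_sum, map_smul]
    simp_rw [hx]
    exact tendsto_finsetSum _ fun k _ => ((hV k).comp hψ.tendsto_atTop).const_smul (x k)
  have hnorm : ∀ x : EuclideanSpace ℝ (Fin 3), ‖∑ k, x k • a.2.1 k‖ = ‖x‖ := by
    intro x
    have h1 := (hAx x).norm
    have h2 : Tendsto (fun n => ‖As (φ (ψ n)) x‖) atTop (𝓝 ‖x‖) := by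
      simp_rw [LinearIsometry.norm_map]; exact tendsto_const_nhds
    exact tendsto_nhds_unique h1 h2
  let L : EuclideanSpace ℝ (Fin 3) →ₗ[ℝ] EuclideanSpace ℝ (Fin 3) :=
    { toFun := fun x => ∑ k, x k • a.2.1 k
      map_add' := by intro x y; simp [add_smul, Finset.sum_add_distrib]
      map_smul' := by intro r x; simp [Finset.smul_sum, smul_smul] }
  let A : EuclideanSpace ℝ (Fin 3) →ₗᵢ[ℝ] EuclideanSpace ℝ (Fin 3) :=
    { toLinearMap := L, norm_map' := hnorm }
  refine ⟨A, fun x => hAx x, ?_⟩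
  -- heights in the window
  let zw : ℤ → ℝ := fun m => if h : -7 ≤ m ∧ m ≤ 7 then a.2.2 ⟨(m + 7).toNat, by omega⟩ else 0
  refine ⟨zw, ?_, ?_⟩
  · intro m h1 h2
    have ht := (hZ ⟨(m + 7).toNat, by omega⟩).comp hψ.tendsto_atTop
    have hm : ((((m + 7).toNat : ℕ) : ℤ) - 7) = m := by omega
    have hzw : zw m = a.2.2 ⟨(m + 7).toNat, by omega⟩ := by simp only [zw, dif_pos (And.intro h1 h2)]
    rw [hzw]
    have : (fun n => zs ((φ ∘ ψ) n) m) = (fun n => zs (φ n) ((((⟨(m + 7).toNat, by omega⟩ : Fin 15) : ℕ) : ℤ) - 7)) ∘ ψ := by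
      funext n; simp only [Function.comp_apply, hm]
    rw [this]; exact ht
  · intro n m h1 h2
    have hw := congrFun (hwψ n) ⟨(m + 7).toNat, by omega⟩
    have hw0 := congrFun (hwψ 0) ⟨(m + 7).toNat, by omega⟩
    have hm : ((((m + 7).toNat : ℕ) : ℤ) - 7) = m := by omega
    simp only [w, hm] at hw hw0
    have hdec : decide (ss (φ (ψ n)) m = 1) = decide (ss (φ (ψ 0)) m = 1) := by rw [hw, hw0]
    show ss (φ (ψ n)) m = ss (φ (ψ 0)) m
    rcases hs (φ (ψ n)) m with h | h <;> rcases hs (φ (ψ 0)) m with h' | h' <;>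
      simp [h, h'] at hdec ⊢

/-- **Extraction** (sequential compactness of admissible pattern parameters) from the core: free extension of the heights outside the window, label congruence, and
`As_n x_n → A x` for convergent `x_n` (isometries are uniformly Lipschitz). -/
theorem extraction :
    ∀ (bs : ℕ → ℝ) (As : ℕ → (EuclideanSpace ℝ (Fin 3) →ₗᵢ[ℝ] EuclideanSpace ℝ (Fin 3))) (ss : ℕ → ℤ → ℤ) (zs : ℕ → ℤ → ℝ), (∀ n, 9 / 10 ≤ bs n ∧ bs n ≤ 1) → (∀ n, Literature.MathematicalPhysics.StatisticalMechanics.IsHaggSeq (ss n)) → (∀ n, (∀ m : ℤ, 39 / 50 * bs n ≤ zs n (m + 1) - zs n m ∧ zs n (m + 1) - zs n m ≤ 17 / 20 * bs n) ∧ zs n 0 = 0) → ∃ φ : ℕ → ℕ, StrictMono φ ∧ ∃ b : ℝ, (9 / 10 ≤ b ∧ b ≤ 1) ∧ Filter.Tendsto (fun n => bs (φ n)) Filter.atTop (nhds b) ∧ ∃ (A : EuclideanSpace ℝ (Fin 3) →ₗᵢ[ℝ] EuclideanSpace ℝ (Fin 3)) (s : ℤ → ℤ) (z : ℤ → ℝ),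 Literature.MathematicalPhysics.StatisticalMechanics.IsHaggSeq s ∧ (∀ m : ℤ, 39 / 50 * b ≤ z (m + 1) - z m ∧ z (m + 1) - z m ≤ 17 / 20 * b) ∧ z 0 = 0 ∧ ∀ m i j : ℤ, |m| ≤ 7 → Filter.Tendsto (fun n => As (φ n) (((i : ℝ) • Literature.MathematicalPhysics.StatisticalMechanics.triangularVec₁ (bs (φ n))) + ((j : ℝ) • Literature.MathematicalPhysics.StatisticalMechanics.triangularVec₂ (bs (φ n))) + ((Literature.MathematicalPhysics.StatisticalMechanics.haggLabel (ss (φ n)) m : ℝ) • Literature.MathematicalPhysics.StatisticalMechanics.barlowOffset (bs (φ n))) + ((zs (φ n)) m • Literature.MathematicalPhysics.StatisticalMechanics.layerNormal 1))) Filter.atTop (nhds (A (((i : ℝ) • Literature.MathematicalPhysics.StatisticalMechanics.triangularVec₁ b) + ((j : ℝ) • Literature.MathematicalPhysics.StatisticalMechanics.triangularVec₂ b) + ((Literature.MathematicalPhysics.StatisticalMechanics.haggLabel s m : ℝ) • Literature.MathematicalPhysics.StatisticalMechanics.barlowOffset b) + (z m • Literature.MathematicalPhysics.StatisticalMechanics.layerNormal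 1)))) := by
  intro bs As ss zs hb hs hz
  obtain ⟨Φ, hΦ, b, hbW, hbt, A, hA, zw, hzw, hwin⟩ := extraction_core bs As ss zs hb hs hz
  have hb0 : 0 ≤ b := by linarith [hbW.1]
  -- limit Hägg sequence and heights
  set s : ℤ → ℤ := ss (Φ 0) with hsdef
  set z : ℤ → ℝ := fun m => if m < -7 then zw (-7) + ((m : ℝ) + 7) * (4 / 5 * b)
    else if 7 < m then zw 7 + ((m : ℝ) - 7) * (4 / 5 * b) else zw m with hzdef
  have hzin : ∀ m : ℤ, -7 ≤ m → m ≤ 7 → z m = zw m := by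
    intro m h1 h2; simp only [hzdef]; rw [if_neg (by omega), if_neg (by omega)]
  -- gap limits inside the window
  have hgapin : ∀ m : ℤ, -7 ≤ m → m ≤ 6 → 39 / 50 * b ≤ zw (m + 1) - zw m ∧ zw (m + 1) - zw m ≤ 17 / 20 * b := by
    intro m h1 h2
    have hd : Tendsto (fun n => zs (Φ n) (m + 1) - zs (Φ n) m) atTop (𝓝 (zw (m + 1) - zw m)) :=
      (hzw (m + 1) (by omega) (by omega)).sub (hzw m h1 (by omega))
    constructor
    · exact le_of_tendsto_of_tendsto' (hbt.const_mul (39 / 50)) hd fun n => ((hz (Φ n)).1 m).1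
    · exact le_of_tendsto_of_tendsto' hd (hbt.const_mul (17 / 20)) fun n => ((hz (Φ n)).1 m).2
  have hgap : ∀ m : ℤ, 39 / 50 * b ≤ z (m + 1) - z m ∧ z (m + 1) - z m ≤ 17 / 20 * b := by
    intro m
    have hc : 39 / 50 * b ≤ 4 / 5 * b ∧ 4 / 5 * b ≤ 17 / 20 * b := ⟨by linarith, by linarith⟩
    rcases (by omega : m < -8 ∨ m = -8 ∨ (-7 ≤ m ∧ m ≤ 6) ∨ m = 7 ∨ 8 ≤ m) with h | h | h | h | h
    · have e1 : z (m + 1) = zw (-7) + ((((m + 1 : ℤ)) : ℝ) + 7) * (4 / 5 * b) := by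
        simp only [hzdef]; rw [if_pos (by omega)]
      have e2 : z m = zw (-7) + ((m : ℝ) + 7) * (4 / 5 * b) := by
        simp only [hzdef]; rw [if_pos (by omega)]
      rw [e1, e2]; push_cast; constructor <;> linarith [hc.1, hc.2]
    · subst h
      have e1 : z (-8 + 1) = zw (-7) := by
        rw [show (-8 : ℤ) + 1 = -7 by norm_num]; exact hzin (-7) (by norm_num) (by norm_num)
      have e2 : z (-8) = zw (-7) + (((-8 : ℤ) : ℝ) + 7) * (4 / 5 * b) := by
        simp only [hzdef]; rw [if_pos (by omega)]
      rw [e1, e2]; push_cast; constructor <;> linarith [hc.1, hc.2]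
    · rw [hzin (m + 1) (by omega) (by omega), hzin m h.1 (by omega)]; exact hgapin m h.1 h.2
    · subst h
      have e1 : z (7 + 1) = zw 7 + ((((7 + 1 : ℤ)) : ℝ) - 7) * (4 / 5 * b) := by
        simp only [hzdef]; rw [if_neg (by omega), if_pos (by omega)]
      have e2 : z 7 = zw 7 := hzin 7 (by norm_num) (by norm_num)
      rw [e1, e2]; push_cast; constructor <;> linarith [hc.1, hc.2]
    · have e1 : z (m + 1) = zw 7 + ((((m + 1 : ℤ)) : ℝ) - 7) * (4 / 5 * b) := by
        simp only [hzdef]; rw [if_neg (by omega), if_pos (by omega)]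
      have e2 : z m = zw 7 + ((m : ℝ) - 7) * (4 / 5 * b) := by
        simp only [hzdef]; rw [if_neg (by omega), if_pos (by omega)]
      rw [e1, e2]; push_cast; constructor <;> linarith [hc.1, hc.2]
  have hz0 : z 0 = 0 := by
    rw [hzin 0 (by norm_num) (by norm_num)]
    have h1 := hzw 0 (by norm_num) (by norm_num)
    have h2 : Tendsto (fun n => zs (Φ n) 0) atTop (𝓝 0) := by
      simp_rw [(fun n => (hz (Φ n)).2 : ∀ n, zs (Φ n) 0 = 0)]; exact tendsto_const_nhds
    exact tendsto_nhds_unique h1 h2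
  refine ⟨Φ, hΦ, b, hbW, hbt, A, s, z, hs (Φ 0), hgap, hz0, ?_⟩
  intro m i j hm
  obtain ⟨hm1, hm2⟩ := abs_le.1 hm
  have hL : ∀ n, haggLabel (ss (Φ n)) m = haggLabel s m :=
    fun n => haggLabel_congr_window _ _ (fun k hk1 hk2 => hwin n k hk1 hk2) m hm
  have hzm : Tendsto (fun n => zs (Φ n) m) atTop (𝓝 (z m)) := by
    rw [hzin m hm1 hm2]; exact hzw m hm1 hm2
  -- convergence of the pattern vectors
  have hPV : Tendsto (fun n => (((i : ℝ) • Literature.MathematicalPhysics.StatisticalMechanics.triangularVec₁ (bs (Φ n))) + ((j : ℝ) • Literature.MathematicalPhysics.StatisticalMechanics.triangularVec₂ (bs (Φ n))) + ((Literature.MathematicalPhysics.StatisticalMechanics.haggLabel (ss (Φ n)) m : ℝ) • Literature.MathematicalPhysics.StatisticalMechanics.barlowOffset (bs (Φ n))) + ((zs (Φ n)) m • Literature.MathematicalPhysics.StatisticalMechanics.layerNormal 1))) atTop (𝓝 (((i : ℝ) • Literature.MathematicalPhysics.StatisticalMechanics.triangularVec₁ b) + ((j : ℝ) • Literature.MathematicalPhysics.StatisticalMechanics.triangularVec₂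 b) + ((Literature.MathematicalPhysics.StatisticalMechanics.haggLabel s m : ℝ) • Literature.MathematicalPhysics.StatisticalMechanics.barlowOffset b) + (z m • Literature.MathematicalPhysics.StatisticalMechanics.layerNormal 1))) := by
    simp only [hL]
    have e1 : ∀ c : ℝ, triangularVec₁ c = c • triangularVec₁ 1 := fun c => by
      ext k; fin_cases k <;> simp [triangularVec₁]
    have e2 : ∀ c : ℝ, triangularVec₂ c = c • triangularVec₂ 1 := fun c => by
      ext k; fin_cases k <;> simp [triangularVec₂] <;> ring
    have e3 : ∀ c : ℝ, barlowOffset c = c • barlowOffset 1 := fun c => by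
      ext k; fin_cases k <;> simp [barlowOffset] <;> ring
    rw [e1 b, e2 b, e3 b]
    simp_rw [e1 (bs (Φ _)), e2 (bs (Φ _)), e3 (bs (Φ _))]
    refine ((((hbt.smul_const _).const_smul _).add ((hbt.smul_const _).const_smul _)).add
      ((hbt.smul_const _).const_smul _)).add (hzm.smul_const _)
  -- isometries: As_n x_n → A x
  rw [tendsto_iff_norm_sub_tendsto_zero]
  have h1 := tendsto_iff_norm_sub_tendsto_zero.1 hPV
  have h2 := tendsto_iff_norm_sub_tendsto_zero.1 (hA (((i : ℝ) • Literature.MathematicalPhysics.StatisticalMechanics.triangularVec₁ b) + ((j : ℝ) • Literature.MathematicalPhysics.StatisticalMechanics.triangularVec₂ b) + ((Literature.MathematicalPhysics.StatisticalMechanics.haggLabel s m : ℝ) • Literature.MathematicalPhysics.StatisticalMechanics.barlowOffset b) + (z m • Literature.MathematicalPhysics.StatisticalMechanics.layerNormal 1)))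
  have h3 : Tendsto (fun n => ‖(((i : ℝ) • Literature.MathematicalPhysics.StatisticalMechanics.triangularVec₁ (bs (Φ n))) + ((j : ℝ) • Literature.MathematicalPhysics.StatisticalMechanics.triangularVec₂ (bs (Φ n))) + ((Literature.MathematicalPhysics.StatisticalMechanics.haggLabel (ss (Φ n)) m : ℝ) • Literature.MathematicalPhysics.StatisticalMechanics.barlowOffset (bs (Φ n))) + ((zs (Φ n)) m • Literature.MathematicalPhysics.StatisticalMechanics.layerNormal 1)) - (((i : ℝ) • Literature.MathematicalPhysics.StatisticalMechanics.triangularVec₁ b) + ((j : ℝ) • Literature.MathematicalPhysics.StatisticalMechanics.triangularVec₂ b) + ((Literature.MathematicalPhysics.StatisticalMechanics.haggLabel s m : ℝ) • Literature.MathematicalPhysics.StatisticalMechanics.barlowOffset b) + (z m • Literature.MathematicalPhysics.StatisticalMechanics.layerNormal 1))‖ + ‖As (Φ n) (((i : ℝ) • Literature.MathematicalPhysics.StatisticalMechanics.triangularVec₁ b) + ((j : ℝ) • Literature.MathematicalPhysics.StatisticalMechanics.triangularVec₂ b) + ((Literature.MathematicalPhysics.StatisticalMechanics.haggLabel s m :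 ℝ) • Literature.MathematicalPhysics.StatisticalMechanics.barlowOffset b) + (z m • Literature.MathematicalPhysics.StatisticalMechanics.layerNormal 1)) - A (((i : ℝ) • Literature.MathematicalPhysics.StatisticalMechanics.triangularVec₁ b) + ((j : ℝ) • Literature.MathematicalPhysics.StatisticalMechanics.triangularVec₂ b) + ((Literature.MathematicalPhysics.StatisticalMechanics.haggLabel s m : ℝ) • Literature.MathematicalPhysics.StatisticalMechanics.barlowOffset b) + (z m • Literature.MathematicalPhysics.StatisticalMechanics.layerNormal 1))‖) atTop (𝓝 0) := by
    have := h1.add h2; simpa using this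
  refine squeeze_zero (fun n => norm_nonneg _) (fun n => ?_) h3
  have : As (Φ n) (((i : ℝ) • Literature.MathematicalPhysics.StatisticalMechanics.triangularVec₁ (bs (Φ n))) + ((j : ℝ) • Literature.MathematicalPhysics.StatisticalMechanics.triangularVec₂ (bs (Φ n))) + ((Literature.MathematicalPhysics.StatisticalMechanics.haggLabel (ss (Φ n)) m : ℝ) • Literature.MathematicalPhysics.StatisticalMechanics.barlowOffset (bs (Φ n))) + ((zs (Φ n)) m • Literature.MathematicalPhysics.StatisticalMechanics.layerNormal 1)) - A (((i : ℝ) • Literature.MathematicalPhysics.StatisticalMechanics.triangularVec₁ b) + ((j : ℝ) • Literature.MathematicalPhysics.StatisticalMechanics.triangularVec₂ b) + ((Literature.MathematicalPhysics.StatisticalMechanics.haggLabel s m : ℝ) • Literature.MathematicalPhysics.StatisticalMechanics.barlowOffset b) + (z m • Literature.MathematicalPhysics.StatisticalMechanics.layerNormal 1)) = As (Φ n) ((((i : ℝ) • Literature.MathematicalPhysics.StatisticalMechanics.triangularVec₁ (bs (Φ n))) + ((j : ℝ) • Literature.MathematicalPhysics.StatisticalMechanics.triangularVec₂ (bs (Φ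 n))) + ((Literature.MathematicalPhysics.StatisticalMechanics.haggLabel (ss (Φ n)) m : ℝ) • Literature.MathematicalPhysics.StatisticalMechanics.barlowOffset (bs (Φ n))) + ((zs (Φ n)) m • Literature.MathematicalPhysics.StatisticalMechanics.layerNormal 1)) - (((i : ℝ) • Literature.MathematicalPhysics.StatisticalMechanics.triangularVec₁ b) + ((j : ℝ) • Literature.MathematicalPhysics.StatisticalMechanics.triangularVec₂ b) + ((Literature.MathematicalPhysics.StatisticalMechanics.haggLabel s m : ℝ) • Literature.MathematicalPhysics.StatisticalMechanics.barlowOffset b) + (z m • Literature.MathematicalPhysics.StatisticalMechanics.layerNormal 1))) + (As (Φ n) (((i : ℝ) • Literature.MathematicalPhysics.StatisticalMechanics.triangularVec₁ b) + ((j : ℝ) • Literature.MathematicalPhysics.StatisticalMechanics.triangularVec₂ b) + ((Literature.MathematicalPhysics.StatisticalMechanics.haggLabel s m : ℝ) • Literature.MathematicalPhysics.StatisticalMechanics.barlowOffset b) + (z m • Literature.MathematicalPhysics.StatisticalMechanics.layerNormal 1)) - A (((i : ℝ) • Literature.MathematicalPhysics.StatisticalMechanics.triangularVec₁ b) + ((j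 : ℝ) • Literature.MathematicalPhysics.StatisticalMechanics.triangularVec₂ b) + ((Literature.MathematicalPhysics.StatisticalMechanics.haggLabel s m : ℝ) • Literature.MathematicalPhysics.StatisticalMechanics.barlowOffset b) + (z m • Literature.MathematicalPhysics.StatisticalMechanics.layerNormal 1))) := by
    rw [map_sub]; abel
  rw [this]
  exact (norm_add_le _ _).trans (by rw [LinearIsometry.norm_map])

end Summit.AtomisticToContinuum.Crystallization.Theorems.ChartedPlanarOrderPatternExtraction
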